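import Literature.NumberTheory.LFunctions.XiTiltedPotential
import Literature.NumberTheory.LFunctions.DeBruijnPhiLogDerivEnvelope
import Literature.Probability.Distributions.ConvexPotentialTails
import HarnessLib

/-!
# Left tail of the tilted laws `ν_s ∝ u^s Φ(u) du` below the bulk `[a_s − τ, ∞)`

Topic `Literature/NumberTheory/LFunctions`; combines `XiTiltedPotential.lean` (the potential
`W_s = −s log u − log Φ`, its curvature `W_s″(u) > s/u² + 16πe^{4u}` and its mode `a_s = xiMode s`) with the
supporting-line tail bounds of `Literature/Probability/Distributions/ConvexPotentialTails.lean`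
(Bagnoli–Bergstrom's inequality `F(b) ≤ f(b)²/f′(b)` for a log-concave density, and the strong-convexity
inequalities of Peypouquet's Prop. 3.12). For `s > 0` and a cut `0 < b < a_s` put `τ := a_s − b` and

  `ρ_L := s/a_s² + 16πe^{4b}`  (a curvature floor of `W_s` on `[b, a_s]`: `xiPotentialDeriv₂_ge_of_mem_Icc`).

Then, for every measurable `S ⊆ (0, b)` (all integrals un-normalised, against Lebesgue measure):

* `setIntegral_rpow_mul_deBruijnPhi_le`: `∫_S u^sΦ(u) du ≤ a_s^s Φ(a_s) · e^{−ρ_L τ²/2}/(ρ_L τ)`;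
* `setIntegral_sub_pow_mul_rpow_mul_deBruijnPhi_le`: `∫_S (b−u)^n u^sΦ(u) du ≤ a_s^sΦ(a_s)·e^{−ρ_Lτ²/2}·n!/(ρ_Lτ)^{n+1}`;
* `setIntegral_mul_rpow_mul_deBruijnPhi_le`: `∫_S f(u) u^sΦ(u) du ≤ a_s^sΦ(a_s)·e^{−ρ_Lτ²/2} ∫_S f(u)e^{−ρ_Lτ(b−u)} du`
  for any weight `f ≥ 0` with `f·e^{−ρ_Lτ(b−·)}` integrable on `S`.

* MODE BRACKET from the envelopes of `L = −Φ′/Φ` (`DeBruijnPhiLogDerivEnvelope.lean`, Lemma E (ii)):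
  `le_xiMode_of_mul_le`: `u₀ > 0`, `u₀(4πe^{4u₀} − 9) ≤ s ⇒ u₀ ≤ a_s`; `xiMode_le_of_le_mul`: `u₀ ≥ 3/2`,
  `s ≤ u₀(4πe^{4u₀} − 9.005) ⇒ a_s ≤ u₀` ("(4.1)": `a(4y − 9.005) ≤ s ≤ a(4y − 9)` at `y = πe^{4a}`).

Dividing by `M_s = ∫₀^∞ u^sΦ ≥ a_s^sΦ(a_s)·G` (a normaliser lower bound, not proved here) turns these into the
tail probability / tail moments `ν_s(u < b) ≤ e^{−ρ_Lτ²/2}/(ρ_Lτ·G)` of the Brascamp–Lieb ladder for the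
Jensen-polynomial moment method ("(4.4)–(4.5)" of the rh-explicit jensen cell's LADDER-BL write-up). Natural
tilts `k : ℕ` are the case `s = (k : ℝ)` (`Real.rpow_natCast`).

## References

* M. Bagnoli, T. Bergstrom, *Log-concave probability and its applications*, Econ. Theory 26 (2005), Lemma 1
  (proof, inequality (2)). [BagnoliBergstrom2005]
* J. Peypouquet, *Convex Optimization in Normed Spaces* (2015), Prop. 3.12. [Peypouquet2015]
* M. W. Coffey, G. Csordas, Math. Comp. 82 (2013), Theorem 2.4. [CoffeyCsordas2013]
-/

noncomputable section

open MeasureTheory Set Real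
open scoped Nat

namespace Literature.NumberTheory.LFunctions

open Literature.Probability.Distributions

variable {s b : ℝ}

/-- **Curvature floor on the left part of the bulk.** For `s ≥ 0`, `0 < b` and `u ∈ [b, a]`:
`W_s″(u) ≥ s/a² + 16πe^{4b}` (from `W_s″(u) > s/u² + 16πe^{4u}`). [cite: CoffeyCsordas2013, Theorem 2.4 (proof)] -/
theorem xiPotentialDeriv₂_ge_of_mem_Icc {a : ℝ} (hs : 0 ≤ s) (hb : 0 < b) {u : ℝ} (hu : u ∈ Icc b a) :
    s / a ^ 2 + 16 * π * exp (4 * b) ≤ xiPotentialDeriv₂ s u := by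
  have hu0 : 0 < u := lt_of_lt_of_le hb hu.1
  have h := xiPotentialDeriv₂_gt_of_pos s hu0
  have h1 : s / a ^ 2 ≤ s / u ^ 2 := by
    apply div_le_div_of_nonneg_left hs (pow_pos hu0 2)
    exact pow_le_pow_left₀ hu0.le hu.2 2
  have h2 : exp (4 * b) ≤ exp (4 * u) := exp_le_exp.2 (by linarith [hu.1])
  nlinarith [pi_pos, h1, h2]

/-- The integrand rewrite `e^{−W_s(u)} = u^sΦ(u)` under a set integral over `S ⊆ (0, ∞)`.
[cite: GORZPNAS2019, §4 (proof of Thm 7)] -/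
theorem setIntegral_mul_exp_neg_xiPotential {S : Set ℝ} (hS : S ⊆ Ioi 0) (hSm : MeasurableSet S)
    (f : ℝ → ℝ) :
    ∫ u in S, f u * exp (-xiPotential s u) = ∫ u in S, f u * (u ^ s * deBruijnPhi u) :=
  setIntegral_congr_fun hSm fun u hu => by rw [exp_neg_xiPotential (hS hu)]

/-- **Left tail of `ν_s`, general weight ("(4.4)").** Let `s > 0`, `0 < b < a_s`, `τ = a_s − b`,
`ρ_L = s/a_s² + 16πe^{4b}`, `S ⊆ (0, b)` measurable, `f ≥ 0` on `S` with `f(u)e^{−ρ_Lτ(b−u)}` integrable on `S`.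
Then `∫_S f(u)·u^sΦ(u) du ≤ a_s^sΦ(a_s) · e^{−ρ_Lτ²/2} · ∫_S f(u) e^{−ρ_Lτ(b−u)} du`.
[cite: BagnoliBergstrom2005, Lemma 1 (proof, (2))] -/
theorem setIntegral_mul_rpow_mul_deBruijnPhi_le (hs : 0 < s) (hb : 0 < b) (hba : b < xiMode s)
    {S : Set ℝ} (hS : S ⊆ Ioo 0 b) (hSm : MeasurableSet S) {f : ℝ → ℝ} (hf : ∀ u ∈ S, 0 ≤ f u)
    (hfi : IntegrableOn (fun u => f u *
      exp (-((s / xiMode s ^ 2 + 16 * π * exp (4 * b)) * (xiMode s - b) * (b - u)))) S) :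
    ∫ u in S, f u * (u ^ s * deBruijnPhi u) ≤
      xiMode s ^ s * deBruijnPhi (xiMode s) *
        exp (-((s / xiMode s ^ 2 + 16 * π * exp (4 * b)) * (xiMode s - b) ^ 2 / 2)) *
        ∫ u in S, f u * exp (-((s / xiMode s ^ 2 + 16 * π * exp (4 * b)) * (xiMode s - b) * (b - u))) := by
  set a := xiMode s with ha_def
  set ρ := s / a ^ 2 + 16 * π * exp (4 * b) with hρ_def
  have ha : 0 < a := xiMode_pos hs
  have hρ0 : 0 < ρ := by positivity
  have hSpos : S ⊆ Ioi 0 := fun u hu => (hS hu).1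
  have hSb : S ⊆ Ioi 0 ∩ Iio b := fun u hu => ⟨(hS hu).1, (hS hu).2⟩
  -- derivative data of `W_s` on `[b, a] ⊆ (0, ∞)`
  have hsub : Icc b a ⊆ Ioi 0 := fun u hu => lt_of_lt_of_le hb hu.1
  have hgd : ∀ x ∈ Icc b a, HasDerivAt (xiPotential s) (xiPotentialDeriv s x) x :=
    fun x hx => hasDerivAt_xiPotential s (ne_of_gt (hsub hx))
  have hg₁ : ∀ x ∈ Icc b a, HasDerivAt (xiPotentialDeriv s) (xiPotentialDeriv₂ s x) x :=
    fun x hx => hasDerivAt_xiPotentialDeriv s (ne_of_gt (hsub hx))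
  have hρle : ∀ x ∈ Icc b a, ρ ≤ xiPotentialDeriv₂ s x :=
    fun x hx => xiPotentialDeriv₂_ge_of_mem_Icc hs.le hb hx
  have hcrit : xiPotentialDeriv s a = 0 := xiPotentialDeriv_xiMode hs
  -- slope and drop at the cut
  have hslope := mul_sub_le_neg_deriv_of_le_deriv2 hba.le hg₁ hρle hcrit
  have hdrop := mul_sq_div_two_le_sub_of_le_deriv2 hba.le hgd hg₁ hρle hcrit
  have hρτ : 0 < ρ * (a - b) := mul_pos hρ0 (sub_pos.2 hba)
  have hβ : 0 < -xiPotentialDeriv s b := lt_of_lt_of_le hρτ hslope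
  have hd : HasDerivAt (xiPotential s) (-(-xiPotentialDeriv s b)) b := by
    rw [neg_neg]; exact hgd b (left_mem_Icc.2 hba.le)
  -- supporting-line bound with the true slope `β = -W′(b)`, then weaken `β ≥ ρτ` inside the integral
  have hpt : ∀ u ∈ S, f u * exp (-(-xiPotentialDeriv s b * (b - u))) ≤ f u * exp (-(ρ * (a - b) * (b - u))) := by
    intro u hu
    refine mul_le_mul_of_nonneg_left (exp_le_exp.2 ?_) (hf u hu)
    have hbu : 0 ≤ b - u := sub_nonneg.2 (le_of_lt (hS hu).2)
    nlinarith
  have hfi' : IntegrableOn (fun u => f u * exp (-(-xiPotentialDeriv s b * (b - u)))) S := by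
    refine Integrable.mono' hfi ?_ (ae_restrict_of_forall_mem hSm fun u hu => ?_)
    · have hfm : AEStronglyMeasurable f (volume.restrict S) := by
        have h1 : AEStronglyMeasurable (fun u => f u * exp (-(ρ * (a - b) * (b - u)))) (volume.restrict S) :=
          hfi.aestronglyMeasurable
        have h2 : AEStronglyMeasurable (fun u => exp (ρ * (a - b) * (b - u))) (volume.restrict S) :=
          (continuous_exp.comp (continuous_const.mul (continuous_const.sub continuous_id))).aestronglyMeasurable
        have h3 := h1.mul h2
        refine h3.congr (Filter.Eventually.of_forall fun u => ?_)
        show (f u * exp (-(ρ * (a - b) * (b - u)))) * exp (ρ * (a - b) * (b - u)) = f u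
        rw [mul_assoc, ← Real.exp_add, neg_add_cancel, Real.exp_zero, mul_one]
      exact hfm.mul (continuous_exp.comp
        (continuous_const.mul (continuous_const.sub continuous_id)).neg).aestronglyMeasurable
    · rw [Real.norm_eq_abs, abs_of_nonneg (mul_nonneg (hf u hu) (exp_pos _).le)]
      exact hpt u hu
  have h1 := setIntegral_mul_exp_neg_le_of_convexOn (convexOn_xiPotential hs.le) (hsub (left_mem_Icc.2 hba.le))
    hd hSpos hSm hf hfi'
  have h2 : ∫ u in S, f u * exp (-(-xiPotentialDeriv s b * (b - u))) ≤
      ∫ u in S, f u * exp (-(ρ * (a - b) * (b - u))) := setIntegral_mono_on hfi' hfi hSm hpt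
  have h3 : exp (-xiPotential s b) ≤ a ^ s * deBruijnPhi a * exp (-(ρ * (a - b) ^ 2 / 2)) := by
    rw [← exp_neg_xiPotential ha, ← Real.exp_add]
    exact exp_le_exp.2 (by linarith)
  have hI0 : 0 ≤ ∫ u in S, f u * exp (-(ρ * (a - b) * (b - u))) :=
    setIntegral_nonneg hSm fun u hu => mul_nonneg (hf u hu) (exp_pos _).le
  rw [← setIntegral_mul_exp_neg_xiPotential hSpos hSm f]
  calc ∫ u in S, f u * exp (-xiPotential s u)
      ≤ exp (-xiPotential s b) * ∫ u in S, f u * exp (-(-xiPotentialDeriv s b * (b - u))) := h1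
    _ ≤ exp (-xiPotential s b) * ∫ u in S, f u * exp (-(ρ * (a - b) * (b - u))) :=
        mul_le_mul_of_nonneg_left h2 (exp_pos _).le
    _ ≤ a ^ s * deBruijnPhi a * exp (-(ρ * (a - b) ^ 2 / 2)) *
          ∫ u in S, f u * exp (-(ρ * (a - b) * (b - u))) := mul_le_mul_of_nonneg_right h3 hI0

/-- **Left tail mass of `ν_s` ("(4.5)": `p = ν(u < b) ≤ p̄`).** For `s > 0`, `0 < b < a_s`, `τ = a_s − b`,
`ρ_L = s/a_s² + 16πe^{4b}` and measurable `S ⊆ (0, b)`: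
`∫_S u^sΦ(u) du ≤ a_s^sΦ(a_s) · e^{−ρ_Lτ²/2}/(ρ_Lτ)`. [cite: BagnoliBergstrom2005, Lemma 1 (proof, (2))] -/
theorem setIntegral_rpow_mul_deBruijnPhi_le (hs : 0 < s) (hb : 0 < b) (hba : b < xiMode s)
    {S : Set ℝ} (hS : S ⊆ Ioo 0 b) (hSm : MeasurableSet S) :
    ∫ u in S, u ^ s * deBruijnPhi u ≤
      xiMode s ^ s * deBruijnPhi (xiMode s) *
        exp (-((s / xiMode s ^ 2 + 16 * π * exp (4 * b)) * (xiMode s - b) ^ 2 / 2)) /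
        ((s / xiMode s ^ 2 + 16 * π * exp (4 * b)) * (xiMode s - b)) := by
  set a := xiMode s with ha_def
  set ρ := s / a ^ 2 + 16 * π * exp (4 * b) with hρ_def
  have ha : 0 < a := xiMode_pos hs
  have hρ0 : 0 < ρ := by positivity
  have hSpos : S ⊆ Ioi 0 := fun u hu => (hS hu).1
  have hSb : S ⊆ Ioi 0 ∩ Iio b := fun u hu => ⟨(hS hu).1, (hS hu).2⟩
  have hsub : Icc b a ⊆ Ioi 0 := fun u hu => lt_of_lt_of_le hb hu.1
  have hgd : ∀ x ∈ Icc b a, HasDerivAt (xiPotential s) (xiPotentialDeriv s x) x :=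
    fun x hx => hasDerivAt_xiPotential s (ne_of_gt (hsub hx))
  have hg₁ : ∀ x ∈ Icc b a, HasDerivAt (xiPotentialDeriv s) (xiPotentialDeriv₂ s x) x :=
    fun x hx => hasDerivAt_xiPotentialDeriv s (ne_of_gt (hsub hx))
  have hρle : ∀ x ∈ Icc b a, ρ ≤ xiPotentialDeriv₂ s x :=
    fun x hx => xiPotentialDeriv₂_ge_of_mem_Icc hs.le hb hx
  have h := setIntegral_exp_neg_le_of_curvature_floor hba hρ0 (convexOn_xiPotential hs.le) hsub hgd hg₁
    hρle (xiPotentialDeriv_xiMode hs) hSb hSm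
  have e1 : ∫ u in S, exp (-xiPotential s u) = ∫ u in S, u ^ s * deBruijnPhi u := by
    have := setIntegral_mul_exp_neg_xiPotential (s := s) hSpos hSm fun _ => 1
    simpa only [one_mul] using this
  rw [← e1, ← exp_neg_xiPotential ha]
  exact h

/-- **Left tail moments of `ν_s`.** For `s > 0`, `0 < b < a_s`, `τ = a_s − b`, `ρ_L = s/a_s² + 16πe^{4b}`,
measurable `S ⊆ (0, b)` and `n : ℕ`:
`∫_S (b−u)^n u^sΦ(u) du ≤ a_s^sΦ(a_s) · e^{−ρ_Lτ²/2} · n!/(ρ_Lτ)^{n+1}`.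
[cite: BagnoliBergstrom2005, Lemma 1 (proof, (2))] -/
theorem setIntegral_sub_pow_mul_rpow_mul_deBruijnPhi_le (hs : 0 < s) (hb : 0 < b) (hba : b < xiMode s)
    {S : Set ℝ} (hS : S ⊆ Ioo 0 b) (hSm : MeasurableSet S) (n : ℕ) :
    ∫ u in S, (b - u) ^ n * (u ^ s * deBruijnPhi u) ≤
      xiMode s ^ s * deBruijnPhi (xiMode s) *
        exp (-((s / xiMode s ^ 2 + 16 * π * exp (4 * b)) * (xiMode s - b) ^ 2 / 2)) *
        ((n ! : ℝ) / ((s / xiMode s ^ 2 + 16 * π * exp (4 * b)) * (xiMode s - b)) ^ (n + 1)) := by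
  set a := xiMode s with ha_def
  set ρ := s / a ^ 2 + 16 * π * exp (4 * b) with hρ_def
  have ha : 0 < a := xiMode_pos hs
  have hρ0 : 0 < ρ := by positivity
  have hSpos : S ⊆ Ioi 0 := fun u hu => (hS hu).1
  have hSb : S ⊆ Ioi 0 ∩ Iio b := fun u hu => ⟨(hS hu).1, (hS hu).2⟩
  have hsub : Icc b a ⊆ Ioi 0 := fun u hu => lt_of_lt_of_le hb hu.1
  have hgd : ∀ x ∈ Icc b a, HasDerivAt (xiPotential s) (xiPotentialDeriv s x) x :=
    fun x hx => hasDerivAt_xiPotential s (ne_of_gt (hsub hx))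
  have hg₁ : ∀ x ∈ Icc b a, HasDerivAt (xiPotentialDeriv s) (xiPotentialDeriv₂ s x) x :=
    fun x hx => hasDerivAt_xiPotentialDeriv s (ne_of_gt (hsub hx))
  have hρle : ∀ x ∈ Icc b a, ρ ≤ xiPotentialDeriv₂ s x :=
    fun x hx => xiPotentialDeriv₂_ge_of_mem_Icc hs.le hb hx
  have h := setIntegral_pow_mul_exp_neg_le_of_curvature_floor hba hρ0 (convexOn_xiPotential hs.le) hsub hgd
    hg₁ hρle (xiPotentialDeriv_xiMode hs) hSb hSm n
  rw [← setIntegral_mul_exp_neg_xiPotential hSpos hSm, ← exp_neg_xiPotential ha]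
  exact h

/-- **Shifted left-tail moments of `ν_s`** (the left pieces `∫_{(0,b)} (c + (b−u))^l u^sΦ` of an un-conditioning /
Minkowski split, `c ≥ 0`): for `s > 0`, `0 < b < a_s`, `τ = a_s − b`, `ρ_L = s/a_s² + 16πe^{4b}`, measurable `S ⊆ (0, b)`:
`∫_S (c + (b−u))^l u^sΦ(u) du ≤ a_s^sΦ(a_s)·e^{−ρ_Lτ²/2}·Σ_{m ≤ l} c^m (l−m)!/(ρ_Lτ)^{l−m+1} C(l,m)`.
[cite: BagnoliBergstrom2005, Lemma 1 (proof, (2))] -/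
theorem setIntegral_add_sub_pow_mul_rpow_mul_deBruijnPhi_le (hs : 0 < s) (hb : 0 < b) (hba : b < xiMode s)
    {S : Set ℝ} (hS : S ⊆ Ioo 0 b) (hSm : MeasurableSet S) {c : ℝ} (hc : 0 ≤ c) (l : ℕ) :
    ∫ u in S, (c + (b - u)) ^ l * (u ^ s * deBruijnPhi u) ≤
      xiMode s ^ s * deBruijnPhi (xiMode s) *
        exp (-((s / xiMode s ^ 2 + 16 * π * exp (4 * b)) * (xiMode s - b) ^ 2 / 2)) *
        ∑ m ∈ Finset.range (l + 1), c ^ m *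
          ((((l - m) ! : ℕ) : ℝ) / ((s / xiMode s ^ 2 + 16 * π * exp (4 * b)) * (xiMode s - b)) ^ (l - m + 1)) *
          (l.choose m : ℝ) := by
  set a := xiMode s with ha_def
  set ρ := s / a ^ 2 + 16 * π * exp (4 * b) with hρ_def
  have ha : 0 < a := xiMode_pos hs
  have hρ0 : 0 < ρ := by positivity
  have hSpos : S ⊆ Ioi 0 := fun u hu => (hS hu).1
  have hSb : S ⊆ Ioi 0 ∩ Iio b := fun u hu => ⟨(hS hu).1, (hS hu).2⟩
  have hsub : Icc b a ⊆ Ioi 0 := fun u hu => lt_of_lt_of_le hb hu.1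
  have hgd : ∀ x ∈ Icc b a, HasDerivAt (xiPotential s) (xiPotentialDeriv s x) x :=
    fun x hx => hasDerivAt_xiPotential s (ne_of_gt (hsub hx))
  have hg₁ : ∀ x ∈ Icc b a, HasDerivAt (xiPotentialDeriv s) (xiPotentialDeriv₂ s x) x :=
    fun x hx => hasDerivAt_xiPotentialDeriv s (ne_of_gt (hsub hx))
  have hρle : ∀ x ∈ Icc b a, ρ ≤ xiPotentialDeriv₂ s x :=
    fun x hx => xiPotentialDeriv₂_ge_of_mem_Icc hs.le hb hx
  have h := setIntegral_add_sub_pow_mul_exp_neg_le_of_curvature_floor hba hρ0 (convexOn_xiPotential hs.le) hsub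
    hgd hg₁ hρle (xiPotentialDeriv_xiMode hs) hc hSb hSm l
  rw [← setIntegral_mul_exp_neg_xiPotential hSpos hSm, ← exp_neg_xiPotential ha]
  exact h

/-! ## Bridges to the written-out vocabulary of `XiTiltedSecondMoment.lean` / `XiTiltedUnconditioning.lean` -/

/-- `W_s″(u) = s/u² + (Φ′(u)² − Φ(u)Φ″(u))/Φ(u)²` (the written-out form used as `hfloor` hypotheses downstream).
[cite: CoffeyCsordas2013, Theorem 2.4 ((2.17))] -/
theorem xiPotentialDeriv₂_eq (s u : ℝ) :
    xiPotentialDeriv₂ s u =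
      s / u ^ 2 + (deBruijnPhiDeriv u ^ 2 - deBruijnPhi u * deBruijnPhiDeriv₂ u) / deBruijnPhi u ^ 2 := rfl

/-- `W_s′(u) = −(s/u + Φ′(u)/Φ(u))`. [cite: CoffeyCsordas2013, §1 (p. 2265)] -/
theorem xiPotentialDeriv_eq (s u : ℝ) :
    xiPotentialDeriv s u = -(s / u + deBruijnPhiDeriv u / deBruijnPhi u) := by
  rw [xiPotentialDeriv, phiNegLogDeriv]; ring

/-- `W_s(u) = −(s·log u + log Φ(u))`. [cite: GORZPNAS2019, §4 (proof of Thm 7)] -/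
theorem xiPotential_eq (s u : ℝ) : xiPotential s u = -(s * Real.log u + Real.log (deBruijnPhi u)) := by
  rw [xiPotential]; ring

/-- The mode in written-out form: `s/a_s + Φ′(a_s)/Φ(a_s) = 0` (the hypothesis `hmode` of
`XiTiltedSecondMoment.integral_sq_sub_mul_phi_pow_le` at `a = xiMode s`). [cite: GORZPNAS2019, §4 (proof of Thm 7)] -/
theorem div_xiMode_add_logDeriv_eq_zero (hs : 0 < s) :
    s / xiMode s + deBruijnPhiDeriv (xiMode s) / deBruijnPhi (xiMode s) = 0 := by
  have h := xiPotentialDeriv_xiMode hs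
  rw [xiPotentialDeriv_eq] at h
  linarith

/-- Conversely, a positive solution of the written-out mode equation IS `xiMode s`.
[cite: GORZPNAS2019, §4 (proof of Thm 7)] -/
theorem eq_xiMode_of_div_add_logDeriv_eq_zero (hs : 0 < s) {a : ℝ} (ha : 0 < a)
    (hmode : s / a + deBruijnPhiDeriv a / deBruijnPhi a = 0) : a = xiMode s := by
  rw [← xiPotentialDeriv_eq_zero_iff hs ha, xiPotentialDeriv_eq, hmode, neg_zero]

/-! ## Natural tilts `k : ℕ` in the tree's integrand convention `Φ(u)·u^k·f(u)` (`XiMomentConcentration.lean`) -/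

/-- Integrand rewrite for natural tilts: `∫_S Φ u·u^k·f u = ∫_S f u·(u^(k:ℝ)·Φ u)` (any measurable `S`).
[cite: GORZPNAS2019, §4 (proof of Thm 7)] -/
theorem setIntegral_deBruijnPhi_mul_pow_mul_eq {S : Set ℝ} (hSm : MeasurableSet S) (k : ℕ) (f : ℝ → ℝ) :
    ∫ u in S, deBruijnPhi u * u ^ k * f u = ∫ u in S, f u * (u ^ (k : ℝ) * deBruijnPhi u) :=
  setIntegral_congr_fun hSm fun u _ => by rw [Real.rpow_natCast]; ring

/-- **Left tail of `ν_k`, `k : ℕ`, general weight, tree convention.** For `0 < k`, `0 < b < a_k`, `τ = a_k − b`,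
`ρ_L = k/a_k² + 16πe^{4b}`, measurable `S ⊆ (0, b)`, `f ≥ 0` on `S` with `f·e^{−ρ_Lτ(b−·)}` integrable on `S`:
`∫_S Φ(u)u^k f(u) du ≤ a_k^kΦ(a_k)·e^{−ρ_Lτ²/2}·∫_S f(u)e^{−ρ_Lτ(b−u)} du`. [cite: BagnoliBergstrom2005, Lemma 1 (proof, (2))] -/
theorem setIntegral_deBruijnPhi_mul_pow_mul_le {k : ℕ} (hk : 0 < k) (hb : 0 < b) (hba : b < xiMode k)
    {S : Set ℝ} (hS : S ⊆ Ioo 0 b) (hSm : MeasurableSet S) {f : ℝ → ℝ} (hf : ∀ u ∈ S, 0 ≤ f u)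
    (hfi : IntegrableOn (fun u => f u *
      exp (-(((k : ℝ) / xiMode k ^ 2 + 16 * π * exp (4 * b)) * (xiMode k - b) * (b - u)))) S) :
    ∫ u in S, deBruijnPhi u * u ^ k * f u ≤
      xiMode k ^ k * deBruijnPhi (xiMode k) *
        exp (-(((k : ℝ) / xiMode k ^ 2 + 16 * π * exp (4 * b)) * (xiMode k - b) ^ 2 / 2)) *
        ∫ u in S, f u * exp (-(((k : ℝ) / xiMode k ^ 2 + 16 * π * exp (4 * b)) * (xiMode k - b) * (b - u))) := by
  have hk' : (0 : ℝ) < k := Nat.cast_pos.2 hk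
  rw [setIntegral_deBruijnPhi_mul_pow_mul_eq hSm k f, ← Real.rpow_natCast (xiMode k) k]
  exact setIntegral_mul_rpow_mul_deBruijnPhi_le hk' hb hba hS hSm hf hfi

/-- **Left tail mass of `ν_k`, `k : ℕ`** (`∫_S Φ u·u^k`, the integrand of `xiMoment k`): for `0 < k`, `0 < b < a_k`,
measurable `S ⊆ (0, b)`: `∫_S Φ(u)u^k du ≤ a_k^kΦ(a_k)·e^{−ρ_Lτ²/2}/(ρ_Lτ)`. [cite: BagnoliBergstrom2005, Lemma 1 (proof, (2))] -/
theorem setIntegral_deBruijnPhi_mul_pow_le {k : ℕ} (hk : 0 < k) (hb : 0 < b) (hba : b < xiMode k)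
    {S : Set ℝ} (hS : S ⊆ Ioo 0 b) (hSm : MeasurableSet S) :
    ∫ u in S, deBruijnPhi u * u ^ k ≤
      xiMode k ^ k * deBruijnPhi (xiMode k) *
        exp (-(((k : ℝ) / xiMode k ^ 2 + 16 * π * exp (4 * b)) * (xiMode k - b) ^ 2 / 2)) /
        (((k : ℝ) / xiMode k ^ 2 + 16 * π * exp (4 * b)) * (xiMode k - b)) := by
  have hk' : (0 : ℝ) < k := Nat.cast_pos.2 hk
  have e : ∫ u in S, deBruijnPhi u * u ^ k = ∫ u in S, u ^ (k : ℝ) * deBruijnPhi u := by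
    have := setIntegral_deBruijnPhi_mul_pow_mul_eq hSm k fun _ => 1
    simpa only [mul_one, one_mul] using this
  rw [e, ← Real.rpow_natCast (xiMode k) k]
  exact setIntegral_rpow_mul_deBruijnPhi_le hk' hb hba hS hSm

/-- **Shifted left-tail moments of `ν_k`, `k : ℕ`, tree convention**: `∫_S Φ(u)u^k(c + (b−u))^l du ≤
a_k^kΦ(a_k)·e^{−ρ_Lτ²/2}·Σ_{m ≤ l} c^m (l−m)!/(ρ_Lτ)^{l−m+1} C(l,m)` (`c ≥ 0`, `S ⊆ (0,b)` measurable, `0 < b < a_k`).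
[cite: BagnoliBergstrom2005, Lemma 1 (proof, (2))] -/
theorem setIntegral_deBruijnPhi_mul_pow_mul_add_sub_pow_le {k : ℕ} (hk : 0 < k) (hb : 0 < b)
    (hba : b < xiMode k) {S : Set ℝ} (hS : S ⊆ Ioo 0 b) (hSm : MeasurableSet S) {c : ℝ} (hc : 0 ≤ c) (l : ℕ) :
    ∫ u in S, deBruijnPhi u * u ^ k * (c + (b - u)) ^ l ≤
      xiMode k ^ k * deBruijnPhi (xiMode k) *
        exp (-(((k : ℝ) / xiMode k ^ 2 + 16 * π * exp (4 * b)) * (xiMode k - b) ^ 2 / 2)) *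
        ∑ m ∈ Finset.range (l + 1), c ^ m *
          ((((l - m) ! : ℕ) : ℝ) / (((k : ℝ) / xiMode k ^ 2 + 16 * π * exp (4 * b)) * (xiMode k - b)) ^ (l - m + 1)) *
          (l.choose m : ℝ) := by
  have hk' : (0 : ℝ) < k := Nat.cast_pos.2 hk
  rw [setIntegral_deBruijnPhi_mul_pow_mul_eq hSm k, ← Real.rpow_natCast (xiMode k) k]
  exact setIntegral_add_sub_pow_mul_rpow_mul_deBruijnPhi_le hk' hb hba hS hSm hc l

/-! ## The mode bracket from the envelopes of `L` -/

/-- **Certified lower bounds for the mode.** For `s > 0` and `u₀ > 0`: if `u₀·(4πe^{4u₀} − 9) ≤ s` then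
`u₀ ≤ a_s` (since `L(u₀) ≤ 4πe^{4u₀} − 9`, so `W_s′(u₀) ≤ 0`). [cite: CoffeyCsordas2013, Proposition 2.1 and (2.9)–(2.10)] -/
theorem le_xiMode_of_mul_le (hs : 0 < s) {u₀ : ℝ} (hu₀ : 0 < u₀)
    (h : u₀ * (4 * π * exp (4 * u₀) - 9) ≤ s) : u₀ ≤ xiMode s := by
  refine le_xiMode_of_mul_phiNegLogDeriv_le hs hu₀ (le_trans ?_ h)
  have hL : phiNegLogDeriv u₀ ≤ 4 * π * exp (4 * u₀) - 9 := neg_deBruijnPhiDeriv_div_le hu₀.le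
  exact mul_le_mul_of_nonneg_left hL hu₀.le

/-- **Certified upper bounds for the mode.** For `s > 0` and `u₀ ≥ 3/2`: if `s ≤ u₀·(4πe^{4u₀} − 9.005)` then
`a_s ≤ u₀` (since `L(u₀) ≥ 4πe^{4u₀} − 9.005`, so `W_s′(u₀) ≥ 0`). [cite: CoffeyCsordas2013, Proposition 2.1 and (2.9)–(2.10)] -/
theorem xiMode_le_of_le_mul (hs : 0 < s) {u₀ : ℝ} (hu₀ : 3 / 2 ≤ u₀)
    (h : s ≤ u₀ * (4 * π * exp (4 * u₀) - 9.005)) : xiMode s ≤ u₀ := by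
  have hu₀' : 0 < u₀ := by linarith
  refine xiMode_le_of_le_mul_phiNegLogDeriv hs hu₀' (le_trans h ?_)
  have hL : 4 * π * exp (4 * u₀) - 9.005 ≤ phiNegLogDeriv u₀ := le_neg_deBruijnPhiDeriv_div hu₀
  exact mul_le_mul_of_nonneg_left hL hu₀'.le

/-- Log form of the lower mode bracket (no exponential of an irrational to evaluate): for `s > 0` and `t > 1`,
if `(log t/4)·(4πt − 9) ≤ s` then `log t/4 ≤ a_s` (take `u₀ = log t/4`, so `e^{4u₀} = t`). Since `a_s` increases with
`s` (`xiMode_strictMonoOn`), one such `t` per threshold `s = 2N₀` serves every `n ≥ N₀`.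
[cite: CoffeyCsordas2013, Proposition 2.1 and (2.9)–(2.10)] -/
theorem log_div_four_le_xiMode (hs : 0 < s) {t : ℝ} (ht : 1 < t)
    (h : Real.log t / 4 * (4 * π * t - 9) ≤ s) : Real.log t / 4 ≤ xiMode s := by
  have hu₀ : 0 < Real.log t / 4 := by have := Real.log_pos ht; positivity
  refine le_xiMode_of_mul_le hs hu₀ ?_
  have he : exp (4 * (Real.log t / 4)) = t := by
    rw [show 4 * (Real.log t / 4) = Real.log t by ring, Real.exp_log (by linarith)]
  rwa [he]

/-- Log form of the upper mode bracket: for `s > 0` and `t ≥ e⁶` (so `u₀ = log t/4 ≥ 3/2`), if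
`s ≤ (log t/4)·(4πt − 9.005)` then `a_s ≤ log t/4`. [cite: CoffeyCsordas2013, Proposition 2.1 and (2.9)–(2.10)] -/
theorem xiMode_le_log_div_four (hs : 0 < s) {t : ℝ} (ht : exp 6 ≤ t)
    (h : s ≤ Real.log t / 4 * (4 * π * t - 9.005)) : xiMode s ≤ Real.log t / 4 := by
  have ht0 : 0 < t := lt_of_lt_of_le (exp_pos 6) ht
  have hu₀ : 3 / 2 ≤ Real.log t / 4 := by
    have h6 : (6 : ℝ) ≤ Real.log t := by
      have := Real.log_le_log (exp_pos 6) ht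
      rwa [Real.log_exp] at this
    linarith
  refine xiMode_le_of_le_mul hs hu₀ ?_
  have he : exp (4 * (Real.log t / 4)) = t := by
    rw [show 4 * (Real.log t / 4) = Real.log t by ring, Real.exp_log ht0]
  rwa [he]

/-- The saddle equation in envelope form: for `s > 0`, `a_s·(4πe^{4a_s} − 9) ≥ s`; and if `a_s ≥ 3/2` then also
`a_s·(4πe^{4a_s} − 9.005) ≤ s` (from `s = a_s·L(a_s)` and Lemma E (ii)). [cite: CoffeyCsordas2013, Proposition 2.1 and (2.9)–(2.10)] -/
theorem xiMode_mul_envelope_bounds (hs : 0 < s) :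
    s ≤ xiMode s * (4 * π * exp (4 * xiMode s) - 9) ∧
      (3 / 2 ≤ xiMode s → xiMode s * (4 * π * exp (4 * xiMode s) - 9.005) ≤ s) := by
  have ha := xiMode_pos hs
  have heq := xiMode_mul_phiNegLogDeriv hs
  constructor
  · have hL : phiNegLogDeriv (xiMode s) ≤ 4 * π * exp (4 * xiMode s) - 9 := neg_deBruijnPhiDeriv_div_le ha.le
    calc s = xiMode s * phiNegLogDeriv (xiMode s) := heq.symm
      _ ≤ xiMode s * (4 * π * exp (4 * xiMode s) - 9) := mul_le_mul_of_nonneg_left hL ha.le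
  · intro h32
    have hL : 4 * π * exp (4 * xiMode s) - 9.005 ≤ phiNegLogDeriv (xiMode s) := le_neg_deBruijnPhiDeriv_div h32
    calc xiMode s * (4 * π * exp (4 * xiMode s) - 9.005) ≤ xiMode s * phiNegLogDeriv (xiMode s) :=
          mul_le_mul_of_nonneg_left hL ha.le
      _ = s := heq

end Literature.NumberTheory.LFunctions

end
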